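import Summits.AtomisticToContinuum.Crystallization.Theorems.FrustratedLawDichotomyStrainedPatchHomValueT2SoundP
import Summits.AtomisticToContinuum.Crystallization.Theorems.FrustratedLawDichotomyStrainedPatchHomValueT2SoundO
import Summits.AtomisticToContinuum.Crystallization.Theorems.FrustratedLawDichotomyStrainedPatchHomValueT2SoundG

/-!
# (I1) part Q — PER-LABEL BOOKKEEPING for the joint value leaf (roadmap for `valueLeafT2J_sound`, step 3b): the record guard gives a POSITIVE radius
# enclosure (`mkDRec_coefL`, `coefL_lo_pos`, `mem_labelQ`, `norm_pos_of_mkDRec`), the value-hull deviation bound of `accLabel`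
# (`abs_sub_le_of_mem_mem`: `H ∈ I`, `h ∈ J` ⟹ `|H − h|·SC ≤ max |I.hi − J.lo| |J.hi − I.lo|`), the SYMMETRY of the real third derivative `T_klm` of
# `…SoundN/…SoundP`, and ★★ the SORTED CUBIC BOUND: `|Σ_{k,l,m<top} T_klm δ_kδ_lδ_m| ≤ Σ_{a≤b≤m<top} μ(a,b,m)·(absHi (thirdOf R a b m)/SC)·|δ_a||δ_b||δ_m|`
# whenever every `T_abm ∈ thirdOf R a b m` (`…SoundO.sum_triple_regroup`)
# (27623 `(H) HomFloor`, hcp half; decomp-a2c hand-1 g49; critic row 1674 (B) (I1) docket).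

No definitions; 0 sorry; standard axioms; no instances / notation / `#eval`.  `--supports stmt-AtomisticToContinuum-27623`.
-/

noncomputable section

namespace Summit.AtomisticToContinuum.Crystallization.Theorems.FrustratedLawDichotomyStrainedPatchHomValueT2Kit

open scoped BigOperators RealInnerProductSpace
open Finset
open Literature.Analysis.ValidatedNumerics.Numerics
open Summit.AtomisticToContinuum.Crystallization.Theorems.ChargedEnergyGapNegative (E3)
open Summit.AtomisticToContinuum.Crystallization.Theorems.FrustratedLawDichotomyStrainedPatchHomEntryGramHcp (dot3 mem_dot3)

/-! ## §1. The record guard: classed coefficients and a positive radius enclosure -/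

/-- `mkDRec top E qI = some R` ⟹ the record's coefficients are `coefL` of the squared-radius enclosure of the tabulated point. [formal bookkeeping] -/
theorem mkDRec_coefL {top : ℕ} {E : Fin 3 × Fin 3 → FI} {qI : Fin 3 → FI} {R : DRec} (h : mkDRec top E qI = some R) :
    coefL (dot3 (tab3 (yOf E (tab3 qI))) (tab3 (yOf E (tab3 qI)))) = some R.co := by
  unfold mkDRec at h
  extract_lets qt y at h
  split at h
  · exact absurd h (by simp)
  rename_i dy gd ze nu gz xo co hco
  extract_lets pt rt at h
  simp only [Option.some.injEq] at h
  subst h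
  exact hco

/-- `coefL Q = some co` ⟹ `0 < Q.lo`. [formal bookkeeping] -/
theorem coefL_lo_pos {Q : FI} {co : CoefL} (h : coefL Q = some co) : 0 < Q.lo := by
  unfold coefL at h
  split at h
  · cases h
  · by_contra hle
    rw [if_pos (not_lt.1 hle)] at h
    cases h

/-- ★ The squared radius `‖Vq‖²` lies in the record's squared-radius enclosure (entries of `V` in `E`, components of `q` in `qI`). [folklore chaining] -/
theorem mem_labelQ (V : E3 →L[ℝ] E3) (q : E3) {E : Fin 3 × Fin 3 → FI} {qI : Fin 3 → FI}
    (hE : ∀ ab : Fin 3 × Fin 3, FI.mem ((V (EuclideanSpace.single ab.2 (1 : ℝ))) ab.1) (E ab)) (hq : ∀ c, FI.mem (q c) (qI c)) :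
    FI.mem (‖V q‖ ^ 2) (dot3 (tab3 (yOf E (tab3 qI))) (tab3 (yOf E (tab3 qI)))) := by
  have hC : ∀ a, FI.mem ((V q) a) (tab3 (yOf E (tab3 qI)) a) := fun a => by
    rw [tab3_apply]; exact mem_yOf V q hE (fun l => by rw [tab3_apply]; exact hq l) a
  have := mem_dot3 hC hC
  rwa [real_inner_self_eq_norm_sq] at this

/-- ★ **A RECORDED LABEL HAS POSITIVE RADIUS**: `mkDRec top E qI = some R` and the memberships ⟹ `0 < ‖Vq‖`. [folklore chaining] -/
theorem norm_pos_of_mkDRec {top : ℕ} {E : Fin 3 × Fin 3 → FI} {qI : Fin 3 → FI} {R : DRec} (h : mkDRec top E qI = some R)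
    (V : E3 →L[ℝ] E3) (q : E3) (hE : ∀ ab : Fin 3 × Fin 3, FI.mem ((V (EuclideanSpace.single ab.2 (1 : ℝ))) ab.1) (E ab))
    (hq : ∀ c, FI.mem (q c) (qI c)) : 0 < ‖V q‖ := by
  have hlo := coefL_lo_pos (mkDRec_coefL h)
  have hm := mem_labelQ V q hE hq
  have h1 : (0 : ℝ) < ‖V q‖ ^ 2 * SC := lt_of_lt_of_le (by exact_mod_cast hlo) hm.1
  have h2 : 0 < ‖V q‖ ^ 2 := pos_of_mul_pos_left h1 SC_pos.le
  exact lt_of_le_of_ne (norm_nonneg _) fun h0 => by rw [← h0] at h2; simp at h2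

/-! ## §2. The value-hull deviation bound -/

/-- ★ `H ∈ I`, `h ∈ J` ⟹ `|H − h| ≤ max |I.hi − J.lo| |J.hi − I.lo| / SC` — the per-entry radius charged by `accLabel`'s value-hull branch. [arithmetic] -/
theorem abs_sub_le_of_mem_mem {H h : ℝ} {I J : FI} (hH : FI.mem H I) (hh : FI.mem h J) :
    |H - h| ≤ ((max |I.hi - J.lo| |J.hi - I.lo| : ℤ) : ℝ) / SC := by
  have hS := SC_pos
  obtain ⟨h1, h2⟩ := hH
  obtain ⟨h3, h4⟩ := hh
  rw [le_div_iff₀ hS, ← abs_of_pos hS, ← abs_mul, abs_le]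
  push_cast
  constructor
  · have : ((J.hi : ℝ) - I.lo) ≤ max |(I.hi : ℝ) - J.lo| |(J.hi : ℝ) - I.lo| := (le_abs_self _).trans (le_max_right _ _)
    nlinarith
  · have : ((I.hi : ℝ) - J.lo) ≤ max |(I.hi : ℝ) - J.lo| |(J.hi : ℝ) - I.lo| := (le_abs_self _).trans (le_max_left _ _)
    nlinarith

/-- `|H − h| ≤ M` ⟹ `h·(ab) − M·(|a||b|) ≤ H·(ab)`. [arithmetic] -/
theorem mul_ge_of_abs_sub_le {H h M a b : ℝ} (hM : |H - h| ≤ M) : h * (a * b) - M * (|a| * |b|) ≤ H * (a * b) := by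
  have h1 : |(H - h) * (a * b)| ≤ M * (|a| * |b|) := by
    rw [abs_mul, abs_mul]; exact mul_le_mul_of_nonneg_right hM (by positivity)
  have h2 := neg_abs_le ((H - h) * (a * b))
  nlinarith

/-! ## §3. Symmetry of the real third derivative -/

/-- `ω_klm = ω_lkm` (written out). [arithmetic] -/
theorem omega_symm12 (V : E3 →L[ℝ] E3) (q : E3) (k l m : ℕ) :
    (∑ cc : Fin 3, (dyR V q l cc * ddyR m k cc + dyR V q k cc * ddyR m l cc + dyR V q m cc * ddyR k l cc)) =
      ∑ cc : Fin 3, (dyR V q k cc * ddyR m l cc + dyR V q l cc * ddyR m k cc + dyR V q m cc * ddyR l k cc) :=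
  Finset.sum_congr rfl fun cc _ => by rw [ddyR_symm l k cc]; ring

/-- `ω_klm = ω_kml` (written out). [arithmetic] -/
theorem omega_symm23 (V : E3 →L[ℝ] E3) (q : E3) (k l m : ℕ) :
    (∑ cc : Fin 3, (dyR V q l cc * ddyR m k cc + dyR V q k cc * ddyR m l cc + dyR V q m cc * ddyR k l cc)) =
      ∑ cc : Fin 3, (dyR V q m cc * ddyR l k cc + dyR V q k cc * ddyR l m cc + dyR V q l cc * ddyR k m cc) :=
  Finset.sum_congr rfl fun cc _ => by rw [ddyR_symm m k cc, ddyR_symm m l cc, ddyR_symm k l cc]; ring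

/-- ★ The real third derivative `T_klm` (the expression of `…SoundN.mem_thirdOf` / `…SoundP.hasDerivAt_hessEntry_label`) is symmetric in `k, l`. [arithmetic] -/
theorem thirdR_symm12 (V : E3 →L[ℝ] E3) (q : E3) (a₁ A B : ℝ) (k l m : ℕ) :
    zetaN V q m * (a₁ * (zetaN V q k * zetaN V q l) + A * nuR V q k l) + A * nuR V q k m * zetaN V q l + A * nuR V q l m * zetaN V q k +
        B * (∑ cc : Fin 3, (dyR V q l cc * ddyR m k cc + dyR V q k cc * ddyR m l cc + dyR V q m cc * ddyR k l cc)) =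
      zetaN V q m * (a₁ * (zetaN V q l * zetaN V q k) + A * nuR V q l k) + A * nuR V q l m * zetaN V q k + A * nuR V q k m * zetaN V q l +
        B * (∑ cc : Fin 3, (dyR V q k cc * ddyR m l cc + dyR V q l cc * ddyR m k cc + dyR V q m cc * ddyR l k cc)) := by
  rw [omega_symm12, nuR_symm V q l k]; ring

/-- ★ `T_klm` is symmetric in `l, m`. [arithmetic] -/
theorem thirdR_symm23 (V : E3 →L[ℝ] E3) (q : E3) (a₁ A B : ℝ) (k l m : ℕ) :
    zetaN V q m * (a₁ * (zetaN V q k * zetaN V q l) + A * nuR V q k l) + A * nuR V q k m * zetaN V q l + A * nuR V q l m * zetaN V q k +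
        B * (∑ cc : Fin 3, (dyR V q l cc * ddyR m k cc + dyR V q k cc * ddyR m l cc + dyR V q m cc * ddyR k l cc)) =
      zetaN V q l * (a₁ * (zetaN V q k * zetaN V q m) + A * nuR V q k m) + A * nuR V q k l * zetaN V q m + A * nuR V q m l * zetaN V q k +
        B * (∑ cc : Fin 3, (dyR V q m cc * ddyR l k cc + dyR V q k cc * ddyR l m cc + dyR V q l cc * ddyR k m cc)) := by
  rw [omega_symm23, nuR_symm V q m l]; ring

/-! ## §4. ★★ The sorted cubic bound -/

/-- Sums supported below `top`: a factor vanishing on `[top, 9)` truncates a `range 9` sum. [formal bookkeeping] -/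
theorem sum_range9_eq_sum_range {top : ℕ} (htop : top ≤ 9) {δ : ℕ → ℝ} (hδ : ∀ k, top ≤ k → k < 9 → δ k = 0) (f : ℕ → ℝ) :
    ∑ k ∈ range 9, f k * δ k = ∑ k ∈ range top, f k * δ k := by
  symm
  refine Finset.sum_subset (Finset.range_subset_range.2 htop) fun k hk hk' => ?_
  rw [hδ k (by simpa using hk') (Finset.mem_range.1 hk), mul_zero]

/-- ★★★ **SORTED CUBIC BOUND.**  If the symmetric real tensor `T` has every entry `T a b m` (`a, b, m < top ≤ 9`) inside `thirdOf R a b m`, then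
`|Σ_{k,l,m<top} T_klm δ_k δ_l δ_m| ≤ Σ_{a,b,m<top} [a ≤ b ≤ m]·μ(a,b,m)·(absHi (thirdOf R a b m)/SC)·(|δ_a||δ_b||δ_m|)` — the shape of `accLabel`'s
Lipschitz loop (`μ = wSym wJ`, `…SoundO.wSym_wJ_eq`). [folklore chaining: `sum_triple_regroup` + `FI.abs_le_absHi`] -/
theorem cubic_le_sorted {top : ℕ} (R : DRec) (T : ℕ → ℕ → ℕ → ℝ) (h12 : ∀ k l m, T k l m = T l k m) (h23 : ∀ k l m, T k l m = T k m l)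
    (hT : ∀ a b m, a < top → b < top → m < top → FI.mem (T a b m) (thirdOf R a b m)) (δ : ℕ → ℝ) :
    |∑ k ∈ range top, ∑ l ∈ range top, ∑ m ∈ range top, T k l m * (δ k * δ l * δ m)| ≤
      ∑ a ∈ range top, ∑ b ∈ range top, ∑ m ∈ range top,
        (if a ≤ b ∧ b ≤ m then (if a = b then (if b = m then (1 : ℝ) else 3) else (if b = m then 3 else 6)) *
          ((((thirdOf R a b m).absHi : ℤ) : ℝ) / SC * (|δ a| * |δ b| * |δ m|)) else 0) := by
  have hS := SC_pos
  -- regroup the ordered sum (the summand `T·δδδ` is symmetric)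
  have hG12 : ∀ k l m, T k l m * (δ k * δ l * δ m) = T l k m * (δ l * δ k * δ m) := fun k l m => by rw [h12]; ring
  have hG23 : ∀ k l m, T k l m * (δ k * δ l * δ m) = T k m l * (δ k * δ m * δ l) := fun k l m => by rw [h23]; ring
  rw [sum_triple_regroup (fun k l m => T k l m * (δ k * δ l * δ m)) hG12 hG23 top]
  refine (Finset.abs_sum_le_sum_abs _ _).trans (Finset.sum_le_sum fun a ha => ?_)
  refine (Finset.abs_sum_le_sum_abs _ _).trans (Finset.sum_le_sum fun b hb => ?_)
  refine (Finset.abs_sum_le_sum_abs _ _).trans (Finset.sum_le_sum fun m hm => ?_)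
  have ha' := Finset.mem_range.1 ha
  have hb' := Finset.mem_range.1 hb
  have hm' := Finset.mem_range.1 hm
  split_ifs with hsort h1 h2 h3
  all_goals try (simp only [abs_zero]; exact le_rfl)
  all_goals
    have habs : |T a b m| ≤ (((thirdOf R a b m).absHi : ℤ) : ℝ) / SC := by
      rw [le_div_iff₀ hS]; exact FI.abs_le_absHi (hT a b m ha' hb' hm')
    rw [abs_mul, abs_mul, abs_mul, abs_mul]
    have hδ : 0 ≤ |δ a| * |δ b| * |δ m| := by positivity
    nlinarith [abs_nonneg (T a b m)]

end Summit.AtomisticToContinuum.Crystallization.Theorems.FrustratedLawDichotomyStrainedPatchHomValueT2Kit
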